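import Summits.ValiantsHypothesis.ValiantsHypothesis.Theorems.BarrierLeverAnchoredDoorHitsLowerPairsXElimItems
import Summits.ValiantsHypothesis.ValiantsHypothesis.Theorems.BarrierLeverAnchoredDoorHitsLowerPairsLTCheck

/-!
# Support item `AnchoredDoorHitsLowerPairs` (stmt-ValiantsHypothesis-22510), line `anchored-peeling`:
# A KERNEL-CHECKABLE FORMAT FOR X-ELIMINATION CERTIFICATES — bitmask data, a Boolean checker, and `XCert` from `check = true`

Helper file (`--supports stmt-ValiantsHypothesis-22510`; cell valiant-natproofs, rung V4, 𝒟-side door (c); prover seat val-np-p1 gen 26; memo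
HOME/val-np-p1/g26/MEMO-conjZ-node-valnp1-g26.md §10). Closes NO item. Sequel of `…XElimItems` (the derived constructor `XCert.step_items`) and of
`…LTCheck` (bitmasks `ofBits`, p645596).

WHY. A certificate of the search lab/xcert2.py is a tree whose nodes carry a variable `a` and an ordered item list; to feed it to the kernel for a named pair
(`r` up to hundreds) the side computations (touched columns, captures, the TOP/BOT index sets) must be done on BITMASKS, not on `Finset (Finset (Fin h))`.
This file gives: rows as bitmasks, labelled columns as (list of anchors as bitmask pairs, vertex bitmask), the Boolean mirror of `touchesB` / `capOf`
(`touchesBB`, `capOfB`), the certificate tree `CTree` and the checker `check h R F t : Bool` (validity of the masks, freshness, the two recursive calls on the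
recomputed TOP and BOT data, leaves by the counting rule). The soundness theorem `xcert_of_check` is the sequel `…XElimCheckSound`.

WHAT THIS IS NOT: no instance here; nothing on crux stmt-ValiantsHypothesis-14610 or on `VP` versus `VNP`.
-/

set_option linter.dupNamespace false

namespace Summit.ValiantsHypothesis.ValiantsHypothesis.Theorems.BarrierLever.AnchoredPeeling

open Finset

namespace XElim

namespace Check

/-! ## 1. Bitmask lemmas -/

section Bits

variable {h : ℕ}

/-- `ofBits` is injective on numbers below `2^h`. -/
theorem ofBits_inj {m n : ℕ} (hm : m < 2 ^ h) (hn : n < 2 ^ h) (he : ofBits h m = ofBits h n) : m = n := by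
  refine Nat.eq_of_testBit_eq (fun i => ?_)
  by_cases hi : i < h
  · have := Finset.ext_iff.mp he ⟨i, hi⟩
    rw [mem_ofBits, mem_ofBits] at this
    simp only at this
    cases h1 : m.testBit i <;> cases h2 : n.testBit i <;> simp_all
  · rw [Nat.testBit_eq_false_of_lt (lt_of_lt_of_le hm (Nat.pow_le_pow_right (by norm_num) (not_lt.mp hi))),
      Nat.testBit_eq_false_of_lt (lt_of_lt_of_le hn (Nat.pow_le_pow_right (by norm_num) (not_lt.mp hi)))]

/-- `ofBits h (2^a) = {a}`. -/
theorem ofBits_two_pow (a : Fin h) : ofBits h (2 ^ a.val) = {a} := by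
  ext b
  rw [mem_ofBits, Finset.mem_singleton]
  constructor
  · intro hb
    by_contra hne
    rw [Nat.testBit_two_pow_of_ne (fun heq => hne (Fin.ext heq.symm))] at hb
    exact Bool.false_ne_true hb
  · rintro rfl; exact Nat.testBit_two_pow_self

/-- The number of set bits below `h`. -/
def pc (h n : ℕ) : ℕ := (bitsFinList h n).length

/-- `pc` is the cardinality of `ofBits`. -/
theorem card_ofBits (n : ℕ) : (ofBits h n).card = pc h n := by
  rw [← toFinset_bitsFinList, List.toFinset_card_of_nodup (bitsFinList_nodup n), pc]

/-- Bitmask inclusion. -/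
def subB (B W : ℕ) : Bool := (B ||| W) == W

/-- `subB` decides inclusion of the decoded finsets (for masks below `2^h`). -/
theorem subB_iff {B W : ℕ} (hB : B < 2 ^ h) (hW : W < 2 ^ h) : subB B W = true ↔ ofBits h B ⊆ ofBits h W := by
  rw [subB, beq_iff_eq]
  constructor
  · intro he b hb
    rw [mem_ofBits] at hb ⊢
    have := congrArg (fun n => n.testBit b.val) he
    simp only [Nat.testBit_lor, hb, Bool.true_or] at this
    exact this.symm
  · intro hsub
    refine Nat.eq_of_testBit_eq (fun i => ?_)
    rw [Nat.testBit_lor]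
    by_cases hi : i < h
    · cases hBi : B.testBit i
      · simp
      · have : (⟨i, hi⟩ : Fin h) ∈ ofBits h W := hsub (mem_ofBits.mpr hBi)
        rw [mem_ofBits] at this; simp [this]
    · rw [Nat.testBit_eq_false_of_lt (lt_of_lt_of_le hB (Nat.pow_le_pow_right (by norm_num) (not_lt.mp hi))),
        Nat.testBit_eq_false_of_lt (lt_of_lt_of_le hW (Nat.pow_le_pow_right (by norm_num) (not_lt.mp hi)))]; simp

/-- Removing a sub-mask: `ofBits (W ^^^ B) = ofBits W \ ofBits B` when `B ⊆ W`. -/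
theorem ofBits_xor_of_sub {B W : ℕ} (hsub : ofBits h B ⊆ ofBits h W) : ofBits h (W ^^^ B) = ofBits h W \ ofBits h B := by
  ext b
  rw [mem_ofBits, Finset.mem_sdiff, mem_ofBits, mem_ofBits, Nat.testBit_xor]
  constructor
  · intro hx
    cases hW : W.testBit b.val <;> cases hBb : B.testBit b.val <;> simp_all
    exact absurd (mem_ofBits.mp (hsub (mem_ofBits.mpr hBb))) (by rw [hW]; simp)
  · rintro ⟨hW, hBb⟩
    rw [hW]; cases hb : B.testBit b.val <;> simp_all

/-- A xor with a sub-mask stays below `2^h`. -/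
theorem xor_lt_two_pow {B W : ℕ} (hB : B < 2 ^ h) (hW : W < 2 ^ h) : W ^^^ B < 2 ^ h := Nat.xor_lt_two_pow hW hB

end Bits

/-! ## 2. Bitmask columns, items, and the Boolean mirror of `touchesB` / `capOf` -/

section Data

/-- A bitmask column: labels as pairs `(root mask, block mask)`, and the vertex mask. -/
abbrev BCol : Type := List (ℕ × ℕ) × ℕ

variable (h : ℕ)

/-- Decoding an anchor. -/
def dAnch (p : ℕ × ℕ) : Anchor h := (ofBits h p.1, ofBits h p.2)

/-- Decoding a column. -/
def dCol (c : BCol) : LCol h := ((c.1.map (dAnch h)).toFinset, ofBits h c.2)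

/-- Decoding a row family. -/
def dRows (R : List ℕ) : Finset (Finset (Fin h)) := (R.map (ofBits h)).toFinset

/-- Decoding a column family. -/
def dCols (F : List BCol) : Finset (LCol h) := (F.map (dCol h)).toFinset

/-- Validity of an anchor pair: both masks below `2^h`. -/
def validP (p : ℕ × ℕ) : Bool := decide (p.1 < 2 ^ h) && decide (p.2 < 2 ^ h)

/-- Validity of a column. -/
def validC (c : BCol) : Bool := decide (c.2 < 2 ^ h) && c.1.all (validP h)

/-- `B` is a block of `W` (bitmask form of `XElim.blocks`). -/
def isBlockOf (B W : ℕ) : Bool := subB B W && (pc h B == 2 || (pc h B == 1 && pc h W % 2 == 1))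

/-- Bitmask mirror of `touchesB`. -/
def touchesBB (a : ℕ) (it : ℕ × ℕ) (c : BCol) : Bool :=
  if it.1 = 2 ^ a then isBlockOf h it.2 c.2 else decide (it ∈ c.1)

/-- Bitmask mirror of `touchedB`. -/
def touchedBB (a : ℕ) (its : List (ℕ × ℕ)) (c : BCol) : Bool := its.any (fun it => touchesBB h a it c)

/-- Bitmask mirror of `capOf`. -/
def capOfB (a : ℕ) (its : List (ℕ × ℕ)) (c : BCol) : BCol :=
  match its.find? (fun it => touchesBB h a it c) with
  | some it => if it.1 = 2 ^ a then ((2 ^ a, it.2) :: c.1, c.2 ^^^ it.2) else c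
  | none => c

variable {h}

/-- Decoding is injective on valid anchor pairs. -/
theorem dAnch_inj {p q : ℕ × ℕ} (hp : validP h p = true) (hq : validP h q = true) (he : dAnch h p = dAnch h q) : p = q := by
  simp only [validP, Bool.and_eq_true, decide_eq_true_eq] at hp hq
  obtain ⟨h1, h2⟩ := Prod.mk.inj he
  exact Prod.ext (ofBits_inj hp.1 hq.1 h1) (ofBits_inj hp.2 hq.2 h2)

/-- `isBlockOf` decides membership in `blocks`. -/
theorem isBlockOf_iff {B W : ℕ} (hB : B < 2 ^ h) (hW : W < 2 ^ h) : isBlockOf h B W = true ↔ ofBits h B ∈ blocks (ofBits h W) := by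
  rw [isBlockOf, mem_blocks, Bool.and_eq_true, subB_iff hB hW, Bool.or_eq_true, Bool.and_eq_true, beq_iff_eq, beq_iff_eq, beq_iff_eq,
    card_ofBits, card_ofBits]
  have hpar : pc h W % 2 = 1 ↔ ¬ 2 ∣ pc h W := by omega
  rw [hpar]

/-- **`touchesBB` mirrors `touchesB`** on valid data. -/
theorem touchesBB_eq {a : Fin h} {it : ℕ × ℕ} {c : BCol} (hit : validP h it = true) (hc : validC h c = true) :
    touchesB a (dAnch h it) (dCol h c) = touchesBB h a.val it c := by
  have hit' := hit
  simp only [validP, Bool.and_eq_true, decide_eq_true_eq] at hit'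
  have hc' := hc
  simp only [validC, Bool.and_eq_true, decide_eq_true_eq, List.all_eq_true] at hc'
  have hroot : (dAnch h it).1 = {a} ↔ it.1 = 2 ^ a.val := by
    rw [dAnch, ← ofBits_two_pow a]
    exact ⟨fun he => ofBits_inj hit'.1 (Nat.pow_lt_pow_right (by norm_num) a.isLt) he, fun he => by rw [he]⟩
  by_cases hr : it.1 = 2 ^ a.val
  · rw [touchesB_of_root (hroot.mpr hr), touchesBB, if_pos hr]
    rw [show (dAnch h it).2 = ofBits h it.2 from rfl, show (dCol h c).2 = ofBits h c.2 from rfl]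
    by_cases hb : isBlockOf h it.2 c.2 = true
    · rw [hb]; exact decide_eq_true ((isBlockOf_iff hit'.2 hc'.1).mp hb)
    · rw [Bool.not_eq_true] at hb; rw [hb]
      exact decide_eq_false (fun hm => by rw [(isBlockOf_iff hit'.2 hc'.1).mpr hm] at hb; exact Bool.noConfusion hb)
  · rw [touchesB_of_not_root (fun he => hr (hroot.mp he)), touchesBB, if_neg hr]
    rw [show (dCol h c).1 = (c.1.map (dAnch h)).toFinset from rfl, decide_eq_decide, List.mem_toFinset, List.mem_map]
    constructor
    · rintro ⟨q, hq, hqe⟩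
      rw [← dAnch_inj (hc'.2 q hq) hit hqe]; exact hq
    · intro hm; exact ⟨it, hm, rfl⟩

/-- `find?` depends only on the predicate's values on the list. -/
theorem find?_congr_mem {α : Type*} {p q : α → Bool} : ∀ {l : List α}, (∀ x ∈ l, p x = q x) → l.find? p = l.find? q
  | [], _ => rfl
  | x :: l, hpq => by
    rw [List.find?_cons, List.find?_cons, hpq x List.mem_cons_self, find?_congr_mem (fun y hy => hpq y (List.mem_cons_of_mem x hy))]

/-- `any` depends only on the predicate's values on the list. -/
theorem any_congr_mem {α : Type*} {p q : α → Bool} : ∀ {l : List α}, (∀ x ∈ l, p x = q x) → l.any p = l.any q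
  | [], _ => rfl
  | x :: l, hpq => by
    rw [List.any_cons, List.any_cons, hpq x List.mem_cons_self, any_congr_mem (fun y hy => hpq y (List.mem_cons_of_mem x hy))]

/-- **`touchedBB` mirrors `touchedB`** on valid data. -/
theorem touchedBB_eq {a : Fin h} {its : List (ℕ × ℕ)} {c : BCol} (hits : its.all (validP h) = true) (hc : validC h c = true) :
    touchedB a (its.map (dAnch h)) (dCol h c) = touchedBB h a.val its c := by
  rw [touchedB, touchedBB, List.any_map]
  rw [List.all_eq_true] at hits
  exact any_congr_mem (fun it hit => by rw [Function.comp_apply]; exact touchesBB_eq (hits it hit) hc)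

/-- **`capOfB` mirrors `capOf`** on valid data. -/
theorem capOfB_eq {a : Fin h} {its : List (ℕ × ℕ)} {c : BCol} (hits : its.all (validP h) = true) (hc : validC h c = true) :
    capOf a (its.map (dAnch h)) (dCol h c) = dCol h (capOfB h a.val its c) := by
  have hits' := hits
  rw [List.all_eq_true] at hits'
  have hc' := hc
  simp only [validC, Bool.and_eq_true, decide_eq_true_eq, List.all_eq_true] at hc'
  have hfind : topItem a (its.map (dAnch h)) (dCol h c) = (its.find? (fun it => touchesBB h a.val it c)).map (dAnch h) := by
    rw [topItem, List.find?_map]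
    congr 1
    exact find?_congr_mem (fun it hit => by rw [Function.comp_apply]; exact touchesBB_eq (hits' it hit) hc)
  rw [capOf, hfind, capOfB]
  cases hf : its.find? (fun it => touchesBB h a.val it c) with
  | none => rfl
  | some it =>
    have hit : it ∈ its := List.mem_of_find?_eq_some hf
    have hv := hits' it hit
    have hv' := hv
    simp only [validP, Bool.and_eq_true, decide_eq_true_eq] at hv'
    have hroot : (dAnch h it).1 = {a} ↔ it.1 = 2 ^ a.val := by
      rw [dAnch, ← ofBits_two_pow a]
      exact ⟨fun he => ofBits_inj hv'.1 (Nat.pow_lt_pow_right (by norm_num) a.isLt) he, fun he => by rw [he]⟩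
    simp only [Option.map_some]
    by_cases hr : it.1 = 2 ^ a.val
    · rw [if_pos (hroot.mpr hr), if_pos hr, capB, dCol, dCol]
      have hpt := List.find?_some hf
      rw [touchesBB, if_pos hr] at hpt
      have hsub : ofBits h it.2 ⊆ ofBits h c.2 := (mem_blocks.mp ((isBlockOf_iff hv'.2 hc'.1).mp hpt)).1
      refine Prod.ext ?_ ?_
      · show insert (({a} : Finset (Fin h)), (dAnch h it).2) (c.1.map (dAnch h)).toFinset = (((2 ^ a.val, it.2) :: c.1).map (dAnch h)).toFinset
        rw [List.map_cons, List.toFinset_cons,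
          show dAnch h (2 ^ a.val, it.2) = ((({a} : Finset (Fin h)), ofBits h it.2) : Anchor h) from by
            show ((ofBits h (2 ^ a.val), ofBits h it.2) : Anchor h) = _; rw [ofBits_two_pow]]
        rfl
      · show ofBits h c.2 \ (dAnch h it).2 = ofBits h (c.2 ^^^ it.2)
        rw [ofBits_xor_of_sub hsub]; rfl
    · rw [if_neg (fun he => hr (hroot.mp he)), if_neg hr]

end Data

/-! ## 3. The certificate tree and the checker -/

section Checker

/-- Certificate trees: `empty`, `leaf`, or a step at the variable `a` with an ordered item list (anchors as bitmask pairs). -/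
inductive CTree : Type
  | empty : CTree
  | leaf : CTree
  | step (a : ℕ) (its : List (ℕ × ℕ)) (t0 t1 : CTree) : CTree

variable (h : ℕ)

/-- The leaf rule of `…XElimLeaf` on bitmask data. -/
def leafOK (U : ℕ) (c : BCol) : Bool :=
  decide (U < 2 ^ h) && validC h c &&
    (decide (c.2 = 0) || decide ((pc h c.2 + 1) / 2 ≤ pc h U)) && (!decide (c.2 = 0) || !c.1.isEmpty || decide (U = 0))

/-- **THE CHECKER.** -/
def check : List ℕ → List BCol → CTree → Bool
  | R, F, .empty => R.isEmpty && F.isEmpty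
  | R, F, .leaf => match R, F with
    | [U], [c] => leafOK h U c
    | _, _ => false
  | R, F, .step a its t0 t1 =>
    decide (a < h) && R.all (fun U => decide (U < 2 ^ h)) && F.all (validC h) && its.all (validP h) &&
    F.all (fun c => c.1.all (fun p => !decide (p.1 = 2 ^ a))) &&
    check (R.filter (fun U => !U.testBit a)) (F.filter (fun c => !touchedBB h a its c)) t0 &&
    check ((R.filter (fun U => U.testBit a)).map (fun U => U ^^^ 2 ^ a)) ((F.filter (fun c => touchedBB h a its c)).map (capOfB h a its)) t1

end Checker

end Check

end XElim

end Summit.ValiantsHypothesis.ValiantsHypothesis.Theorems.BarrierLever.AnchoredPeeling
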